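import Literature.NumberTheory.ConnesMoscovici2022.UVProlateBoundaryFunctional
import Literature.NumberTheory.ConnesConsani2021.SoninSpaceInfiniteDimensional
import Literature.Analysis.UnboundedOperators.CompactResolventEigenbasis
import Literature.Analysis.UnboundedOperators.VonNeumannDecomposition
import HarnessLib

/-!
# Connes–Moscovici 2022, Theorem 1.6 (iv): "the spectrum of `W_sa` is … unbounded on both sides" —
# the SIGN CLAUSE, and the assembly of clause (iv) from a compact resolvent (PROVED, RH-FREE)

LINE 1 — FRAMING. RH-FREE corpus literature (elementary spectral bookkeeping for the prolate wave
operator `W_λ = −∂(λ² − x²)∂ + (2πλx)²` on `L²(ℝ)`; sequel row of the Connes–Consani corpus, no leaf /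
binder role).  bears_on: LADDER-RH W-C/W-P.  WHAT THIS IS NOT: any claim about RH; nothing in this
file mentions `RiemannHypothesis` or bears on the truth of RH.

Source: A. Connes, H. Moscovici, *The UV prolate spectrum matches the zeros of zeta*, PNAS 119 (2022)
[bib: `ConnesMoscovici2022`], Theorem 1.6 (iv) = arXiv:2112.05500 Theorem 2.6 (iv) (chunk
p0006:L79; proof L105–L114): "The spectrum of `W_sa` is discrete and unbounded on both sides."  The
printed proof: "`P_λ W_sa` and `(I − P_λ) W_sa` are selfadjoint … covered by standard results in
Sturm–Liouville theory … all four endpoints are limit circle case … By well-known results ([naimark]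
page 90, [zettl]) it follows that both … have discrete spectrum and that the spectrum of the latter is
unbounded on both sides."

## What is here (theorems only; no definition, no named fact)

The tree types clause (iv) as `HasDiscreteSpectrumUnboundedBothSides W` (an orthonormal eigenbasis
indexed by `ℕ`, real eigenvalues `μₙ` with `|μₙ| → ∞`, `{μₙ}` bounded neither above nor below;
`UVProlateSpectrum.lean`).  Its discharge splits into three bricks:
(a) the self-adjoint realisation has COMPACT RESOLVENT (the Sturm–Liouville / limit-circle input;
cell seat t15, not here); (b) compact resolvent ⇒ orthonormal eigenbasis with `|μₙ| → ∞` (abstract;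
the tree's `Literature.Analysis.UnboundedOperators.exists_hilbertBasis_nat_eigenvectors_of_compact_resolvent`,
Schmüdgen 2012 Prop. 5.12); (c) THIS FILE: the SIGN CLAUSE "unbounded on BOTH sides" and the glue.

* §1 `inner_prolateCore_self_eq_integral` — the Rayleigh identity on the Schwartz core:
  `⟪ψ, Wψ⟫ = ∫ ((λ² − x²)|ψ′(x)|² + (2πλ)²x²|ψ(x)|²) dx` (one integration by parts).
* §2 `exists_schwartz_modulated`, `exists_schwartz_rayleigh_gt` / `exists_schwartz_rayleigh_lt` —
  the quadratic form of `W` on the core is bounded NEITHER above NOR below (`λ > 0`): a modulated bump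
  `ψ_k(x) = g(x)e^{ikx}` (real smooth compactly supported `g`) has `|ψ_k′|² = g′² + k²g²`, so
  `⟪ψ_k, Wψ_k⟫ = ⟪g, Wg⟫ + k² ∫ (λ² − x²) g²` with `‖ψ_k‖ = ‖g‖`; for `g` supported in `|x| < λ` this
  tends to `+∞`, for `g` supported in `x > λ` to `−∞` (the kinetic coefficient `λ² − x²` changes
  sign at `±λ` — the operator-specific reason for "both sides").
* §4 also: `prolateCore_le_of_isSelfAdjoint` — a self-adjoint `W ⊂ W_max` extends the core
  (`W|_𝒮 ⊂ W_max* ⊂ W* = W`), so the assembly applies to every `W_sa` with `IsProlateSA λ W`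
  (`hasDiscreteSpectrumUnboundedBothSides_of_isProlateSA`).
* §3 `not_bddAbove_of_eigenbasis` / `not_bddBelow_of_eigenbasis` — for any SYMMETRIC extension `W` of
  the core and any orthonormal eigenbasis `(bᵢ, μᵢ)` of `W`: `¬ BddAbove (range μ)`, `¬ BddBelow (range μ)`
  (Parseval: `⟪ξ, Wξ⟫ = Σ μᵢ |⟪bᵢ, ξ⟫|²`).
* §4 (private `not_finiteDimensional_L2R`, from the tree's `not_finiteDimensional_soninSpace_of_nonneg`) the ASSEMBLY
  `hasDiscreteSpectrumUnboundedBothSides_of_compact_resolvent`: a self-adjoint `W` with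
  `prolateCore λ ≤ W` and compact resolvent satisfies `HasDiscreteSpectrumUnboundedBothSides W`.

Deviation from print: the sign clause is obtained from explicit test functions rather than from the
oscillation (LCO) theory of [naimark]/[zettl]; same content for clause (iv) as typed.

Nothing in this file bears on the truth of RH.
-/

noncomputable section

open Complex Set MeasureTheory Filter SchwartzMap
open scoped Real Topology ContDiff InnerProductSpace ComplexConjugate

namespace Literature.NumberTheory.ConnesMoscovici2022

open Literature.NumberTheory.ConnesConsani2021 Literature.NumberTheory.ConnesConsani2024
open Literature.Analysis.UnboundedOperators

/-! ## §1. The Rayleigh identity on the Schwartz core -/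

section Rayleigh

variable (lam : ℝ)

/-- `(p ψ′)` as a Schwartz map, pointwise. [folklore] -/
private theorem smulLeft_deriv_apply (ψ : 𝓢(ℝ, ℂ)) (y : ℝ) :
    smulLeftCLM ℂ (pCoeff lam) (derivCLM ℂ ℂ ψ) y = pCoeff lam y * deriv ψ y := by
  rw [smulLeftCLM_apply_apply (pCoeff_hasTemperateGrowth lam), derivCLM_apply, smul_eq_mul]

/-- RH-FREE (PROVED). **Rayleigh identity on the core**: for a Schwartz function `ψ`,
`⟪ψ, W ψ⟫_{L²} = ∫ ((λ² − x²)|ψ′(x)|² + (2πλ)² x² |ψ(x)|²) dx` (one integration by parts,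
`∫ ψ̄ · (−(pψ′)′) = ∫ p |ψ′|²`). [cite: ConnesMoscovici2022, §1 eq. (1.1) and Thm 1.6 (iv) (= arXiv (2.1), Thm 2.6 (iv), chunk p0004:L5–L15, p0006:L105–L114)] -/
theorem inner_prolateCore_self_eq_integral (ψ : 𝓢(ℝ, ℂ)) :
    ⟪(schwartzToL2 ψ : L2R),
        prolateCore lam ⟨schwartzToL2 ψ, LinearMap.mem_range_self _ ψ⟩⟫_ℂ =
      ((∫ x, ((lam ^ 2 - x ^ 2) * ‖deriv ψ x‖ ^ 2 + (2 * π * lam) ^ 2 * x ^ 2 * ‖ψ x‖ ^ 2) : ℝ) : ℂ) := by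
  rw [prolateCore_apply]
  change ⟪(ψ.toLp 2 volume : L2R), ((prolateSchwartz lam ψ).toLp 2 volume : L2R)⟫_ℂ = _
  rw [L2.inner_def]
  set ψc : 𝓢(ℝ, ℂ) := SchwartzMap.postcompCLM (Complex.conjCLE : ℂ →L[ℝ] ℂ) ψ with hψc
  have hψc_apply : (⇑ψc : ℝ → ℂ) = fun t ↦ star (ψ t) := funext fun _ ↦ rfl
  have h1 : ∫ t, ⟪(ψ.toLp 2 volume : L2R) t, ((prolateSchwartz lam ψ).toLp 2 volume : L2R) t⟫_ℂ =
      ∫ t, ψc t * prolateSchwartz lam ψ t := by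
    refine integral_congr_ae ?_
    filter_upwards [(prolateSchwartz lam ψ).coeFn_toLp 2 volume, ψ.coeFn_toLp 2 volume] with t h1 h2
    rw [h1, h2, hψc_apply]
    simp [mul_comm]
  rw [h1]
  -- integrability of products of Schwartz functions
  have hi : ∀ f g : 𝓢(ℝ, ℂ), Integrable (fun t ↦ f t * g t) := fun f g ↦
    (f.memLp 2 volume).integrable_mul (g.memLp 2 volume)
  -- split `W ψ = −(pψ′)′ + qψ`
  have eW : (fun t ↦ ψc t * prolateSchwartz lam ψ t) = fun t ↦
      -(ψc t * deriv (smulLeftCLM ℂ (pCoeff lam) (derivCLM ℂ ℂ ψ)) t) +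
        ψc t * (smulLeftCLM ℂ (qCoeff lam) ψ) t := by
    funext t
    rw [prolateSchwartz_apply', smulLeftCLM_apply_apply (qCoeff_hasTemperateGrowth lam), smul_eq_mul]
    have e : (fun y ↦ pCoeff lam y * deriv ψ y) = ⇑(smulLeftCLM ℂ (pCoeff lam) (derivCLM ℂ ℂ ψ)) := by
      funext y; rw [smulLeft_deriv_apply]
    rw [e]; ring
  have hI1 : Integrable (fun t ↦ ψc t * deriv (smulLeftCLM ℂ (pCoeff lam) (derivCLM ℂ ℂ ψ)) t) := by
    have := hi ψc (derivCLM ℂ ℂ (smulLeftCLM ℂ (pCoeff lam) (derivCLM ℂ ℂ ψ)))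
    simpa only [derivCLM_apply] using this
  have hI1n : Integrable (fun t ↦ -(ψc t * deriv (smulLeftCLM ℂ (pCoeff lam) (derivCLM ℂ ℂ ψ)) t)) :=
    hI1.neg
  rw [eW, integral_add hI1n (hi _ _), integral_neg]
  -- integration by parts: `∫ ψ̄ (pψ′)′ = −∫ ψ̄′ (pψ′)` and `ψ̄′ = conj ψ′`
  rw [SchwartzMap.integral_mul_deriv_eq_neg_deriv_mul ψc (smulLeftCLM ℂ (pCoeff lam) (derivCLM ℂ ℂ ψ)),
    neg_neg]
  have hdc : ∀ t, deriv ψc t = star (deriv ψ t) := by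
    intro t
    rw [hψc_apply, deriv.star' (f := (⇑ψ))]
  have e1 : (fun t ↦ deriv ψc t * smulLeftCLM ℂ (pCoeff lam) (derivCLM ℂ ℂ ψ) t) =
      fun t ↦ (((lam ^ 2 - t ^ 2) * ‖deriv ψ t‖ ^ 2 : ℝ) : ℂ) := by
    funext t
    rw [hdc, smulLeft_deriv_apply, pCoeff, mul_left_comm, Complex.star_def, Complex.conj_mul']
    push_cast; ring
  have e2 : (fun t ↦ ψc t * smulLeftCLM ℂ (qCoeff lam) ψ t) =
      fun t ↦ (((2 * π * lam) ^ 2 * t ^ 2 * ‖ψ t‖ ^ 2 : ℝ) : ℂ) := by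
    funext t
    rw [smulLeftCLM_apply_apply (qCoeff_hasTemperateGrowth lam), smul_eq_mul, hψc_apply, qCoeff,
      mul_left_comm, Complex.star_def, Complex.conj_mul']
    push_cast; ring
  have hA : Integrable (fun t : ℝ ↦ (lam ^ 2 - t ^ 2) * ‖deriv ψ t‖ ^ 2) := by
    have := hi (derivCLM ℂ ℂ ψc) (smulLeftCLM ℂ (pCoeff lam) (derivCLM ℂ ℂ ψ))
    rw [show (fun t ↦ (derivCLM ℂ ℂ ψc) t * smulLeftCLM ℂ (pCoeff lam) (derivCLM ℂ ℂ ψ) t) =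
      fun t ↦ deriv ψc t * smulLeftCLM ℂ (pCoeff lam) (derivCLM ℂ ℂ ψ) t from
        funext fun t ↦ by rw [derivCLM_apply], e1] at this
    simpa only [RCLike.re_to_complex, Complex.ofReal_re] using this.re
  have hB : Integrable (fun t : ℝ ↦ (2 * π * lam) ^ 2 * t ^ 2 * ‖ψ t‖ ^ 2) := by
    have := hi ψc (smulLeftCLM ℂ (qCoeff lam) ψ)
    rw [e2] at this
    simpa only [RCLike.re_to_complex, Complex.ofReal_re] using this.re
  rw [show (fun t ↦ deriv ψc t * smulLeftCLM ℂ (pCoeff lam) (derivCLM ℂ ℂ ψ) t) =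
      fun t ↦ (((lam ^ 2 - t ^ 2) * ‖deriv ψ t‖ ^ 2 : ℝ) : ℂ) from e1, e2,
    integral_complex_ofReal, integral_complex_ofReal, ← Complex.ofReal_add, ← integral_add hA hB]

end Rayleigh

/-! ## §2. Test functions: the form of `W` on the core is bounded neither above nor below -/

section TestFunctions

variable (lam : ℝ)

/-- The `L²` norm of (the class of) a Schwartz function: `‖ψ‖² = ∫ |ψ|²`. [folklore] -/
private theorem norm_sq_schwartzToL2 (ψ : 𝓢(ℝ, ℂ)) :
    ‖(schwartzToL2 ψ : L2R)‖ ^ 2 = ∫ x, ‖ψ x‖ ^ 2 := by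
  rw [← inner_self_eq_norm_sq (𝕜 := ℂ)]
  change RCLike.re ⟪(ψ.toLp 2 volume : L2R), (ψ.toLp 2 volume : L2R)⟫_ℂ = _
  rw [L2.inner_def]
  have h1 : ∫ t, ⟪(ψ.toLp 2 volume : L2R) t, (ψ.toLp 2 volume : L2R) t⟫_ℂ =
      ∫ t, ((‖ψ t‖ ^ 2 : ℝ) : ℂ) := by
    refine integral_congr_ae ?_
    filter_upwards [ψ.coeFn_toLp 2 volume] with t ht
    rw [ht, inner_self_eq_norm_sq_to_K]
    norm_cast
  rw [h1, integral_complex_ofReal, RCLike.re_to_complex, Complex.ofReal_re]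

/-- `|g(x) e^{ikx}|² = g(x)²` for real `g`. [folklore] -/
private theorem norm_sq_mul_exp (g : ℝ → ℝ) (k x : ℝ) :
    ‖(g x : ℂ) * cexp (((k * x : ℝ) : ℂ) * I)‖ ^ 2 = g x ^ 2 := by
  rw [norm_mul, Complex.norm_exp_ofReal_mul_I, mul_one, Complex.norm_real, Real.norm_eq_abs, sq_abs]

/-- `(g e^{ikx})′ = (g′ + ikg) e^{ikx}`. [folklore] -/
private theorem hasDerivAt_mul_exp {g : ℝ → ℝ} (hg : Differentiable ℝ g) (k x : ℝ) :
    HasDerivAt (fun y : ℝ ↦ (g y : ℂ) * cexp (((k * y : ℝ) : ℂ) * I))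
      ((((deriv g x : ℝ) : ℂ) + ((g x * k : ℝ) : ℂ) * I) * cexp (((k * x : ℝ) : ℂ) * I)) x := by
  have h1 : HasDerivAt (fun y : ℝ ↦ (g y : ℂ)) ((deriv g x : ℝ) : ℂ) x :=
    (hg x).hasDerivAt.ofReal_comp
  have h2 : HasDerivAt (fun y : ℝ ↦ ((k * y : ℝ) : ℂ) * I) (((k : ℝ) : ℂ) * I) x := by
    have h : HasDerivAt (fun y : ℝ ↦ k * y) k x := by
      simpa using (hasDerivAt_id x).const_mul k
    exact h.ofReal_comp.mul_const I
  have h3 : HasDerivAt (fun y : ℝ ↦ (g y : ℂ) * cexp (((k * y : ℝ) : ℂ) * I))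
      (((deriv g x : ℝ) : ℂ) * cexp (((k * x : ℝ) : ℂ) * I) +
        (g x : ℂ) * (cexp (((k * x : ℝ) : ℂ) * I) * (((k : ℝ) : ℂ) * I))) x := h1.mul h2.cexp
  refine h3.congr_deriv ?_
  push_cast
  ring

/-- `|(g e^{ikx})′|² = g′² + k²g²` for real `g` (the cross terms cancel). [folklore] -/
private theorem norm_sq_deriv_mul_exp {g : ℝ → ℝ} (hg : Differentiable ℝ g) (k x : ℝ) :
    ‖deriv (fun y : ℝ ↦ (g y : ℂ) * cexp (((k * y : ℝ) : ℂ) * I)) x‖ ^ 2 =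
      deriv g x ^ 2 + k ^ 2 * g x ^ 2 := by
  rw [(hasDerivAt_mul_exp hg k x).deriv, norm_mul, Complex.norm_exp_ofReal_mul_I, mul_one,
    Complex.norm_add_mul_I, Real.sq_sqrt (by positivity)]
  ring

/-- Off the topological support of `g`, both `g` and `g′` vanish. [folklore] -/
private theorem deriv_eq_zero_of_notMem_tsupport {g : ℝ → ℝ} {x : ℝ} (hx : x ∉ tsupport g) :
    deriv g x = 0 :=
  Function.notMem_support.mp fun h ↦ hx (support_deriv_subset h)

/-- A continuous function vanishing off the (compact) topological support of `g` is integrable.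
[folklore] -/
private theorem integrable_of_tsupport {g : ℝ → ℝ} (hsupp : HasCompactSupport g) {F : ℝ → ℝ}
    (hF : Continuous F) (h0 : ∀ x ∉ tsupport g, F x = 0) : Integrable F :=
  hF.integrable_of_hasCompactSupport (HasCompactSupport.intro hsupp h0)

/-- RH-FREE (PROVED). **The form of `W` on a modulated bump.** For a smooth compactly supported real
`g` and `k ∈ ℝ`, `ψ_k(x) = g(x)e^{ikx}` is a Schwartz function with `‖ψ_k‖² = ∫ g²` and
`⟪ψ_k, Wψ_k⟫ = ∫ ((λ² − x²)g′² + (2πλ)²x²g²) + k² ∫ (λ² − x²)g²` (since `|ψ_k′|² = g′² + k²g²`):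
the quadratic form grows like `k²` with the sign of `∫ (λ² − x²) g²`, i.e. of the kinetic
coefficient `p = λ² − x²` on the support of `g`. [cite: ConnesMoscovici2022, §1 eq. (1.1) and Thm 1.6 (iv) (= arXiv (2.1), Thm 2.6 (iv), chunk p0004:L5–L9, p0006:L105–L114)] -/
theorem exists_schwartz_modulated {g : ℝ → ℝ} (hg : ContDiff ℝ ∞ g) (hsupp : HasCompactSupport g)
    (k : ℝ) : ∃ ψ : 𝓢(ℝ, ℂ),
      ‖(schwartzToL2 ψ : L2R)‖ ^ 2 = ∫ x, g x ^ 2 ∧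
      (⟪(schwartzToL2 ψ : L2R),
          prolateCore lam ⟨schwartzToL2 ψ, LinearMap.mem_range_self _ ψ⟩⟫_ℂ).re =
        (∫ x, ((lam ^ 2 - x ^ 2) * deriv g x ^ 2 + (2 * π * lam) ^ 2 * x ^ 2 * g x ^ 2)) +
          k ^ 2 * ∫ x, (lam ^ 2 - x ^ 2) * g x ^ 2 := by
  -- the modulated bump is smooth with compact support, hence a Schwartz function
  have hψc : ContDiff ℝ ∞ (fun y : ℝ ↦ (g y : ℂ) * cexp (((k * y : ℝ) : ℂ) * I)) := by
    have h1 : ContDiff ℝ ∞ (fun y : ℝ ↦ (g y : ℂ)) := Complex.ofRealCLM.contDiff.comp hg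
    have h2 : ContDiff ℝ ∞ (fun y : ℝ ↦ ((k * y : ℝ) : ℂ)) :=
      Complex.ofRealCLM.contDiff.comp (contDiff_const.mul contDiff_id)
    exact h1.mul (h2.mul contDiff_const).cexp
  have hψs : HasCompactSupport (fun y : ℝ ↦ (g y : ℂ) * cexp (((k * y : ℝ) : ℂ) * I)) :=
    HasCompactSupport.intro hsupp fun x hx ↦ by simp [image_eq_zero_of_notMem_tsupport hx]
  obtain ⟨ψ, hcoe⟩ : ∃ ψ : 𝓢(ℝ, ℂ), ⇑ψ = fun y : ℝ ↦ (g y : ℂ) * cexp (((k * y : ℝ) : ℂ) * I) :=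
    ⟨hψs.toSchwartzMap hψc, rfl⟩
  have hgd : Differentiable ℝ g := hg.differentiable (by simp)
  have hgc : Continuous g := hg.continuous
  have hdc : Continuous (deriv g) := hg.continuous_deriv (by simp)
  refine ⟨ψ, ?_, ?_⟩
  · rw [norm_sq_schwartzToL2, hcoe]
    simp only [norm_sq_mul_exp]
  · rw [inner_prolateCore_self_eq_integral, Complex.ofReal_re, hcoe]
    simp only [norm_sq_mul_exp, norm_sq_deriv_mul_exp hgd]
    have hI1 : Integrable (fun x : ℝ ↦
        (lam ^ 2 - x ^ 2) * deriv g x ^ 2 + (2 * π * lam) ^ 2 * x ^ 2 * g x ^ 2) :=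
      integrable_of_tsupport hsupp (by fun_prop) fun x hx ↦ by
        simp [image_eq_zero_of_notMem_tsupport hx, deriv_eq_zero_of_notMem_tsupport hx]
    have hI2 : Integrable (fun x : ℝ ↦ k ^ 2 * ((lam ^ 2 - x ^ 2) * g x ^ 2)) :=
      integrable_of_tsupport hsupp (by fun_prop) fun x hx ↦ by
        simp [image_eq_zero_of_notMem_tsupport hx]
    rw [← integral_const_mul, ← integral_add hI1 hI2]
    congr 1
    funext x
    ring

/-- RH-FREE (PROVED). **The form of `W` on the core is not bounded above** (`λ > 0`): for every
`C` there is a Schwartz `ψ` with `⟪ψ, Wψ⟫ > C‖ψ‖²` — modulate a bump supported in `|x| ≤ λ/2`,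
where the kinetic coefficient `λ² − x²` is positive. [cite: ConnesMoscovici2022, Thm 1.6 (iv) (= arXiv Thm 2.6 (iv), chunk p0006:L79, L105–L114)] -/
theorem exists_schwartz_rayleigh_gt (hlam : 0 < lam) (C : ℝ) :
    ∃ ψ : 𝓢(ℝ, ℂ), C * ‖(schwartzToL2 ψ : L2R)‖ ^ 2 <
      (⟪(schwartzToL2 ψ : L2R),
          prolateCore lam ⟨schwartzToL2 ψ, LinearMap.mem_range_self _ ψ⟩⟫_ℂ).re := by
  let β : ContDiffBump (0 : ℝ) := ⟨lam / 4, lam / 2, by positivity, by linarith⟩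
  have hgs : ContDiff ℝ ∞ (β : ℝ → ℝ) := β.contDiff
  have hgc : HasCompactSupport (β : ℝ → ℝ) := β.hasCompactSupport
  set R₀ : ℝ := ∫ x, ((lam ^ 2 - x ^ 2) * deriv (β : ℝ → ℝ) x ^ 2 +
    (2 * π * lam) ^ 2 * x ^ 2 * (β : ℝ → ℝ) x ^ 2) with hR₀
  set J : ℝ := ∫ x, (lam ^ 2 - x ^ 2) * (β : ℝ → ℝ) x ^ 2 with hJdef
  set N : ℝ := ∫ x, (β : ℝ → ℝ) x ^ 2 with hN
  -- `J > 0`: the integrand is continuous, nonnegative, and equals `λ²` at `0`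
  have hJ : 0 < J := by
    refine integral_pos_of_integrable_nonneg_nonzero (x := 0) (by fun_prop) ?_ ?_ ?_
    · exact integrable_of_tsupport hgc (by fun_prop) fun x hx ↦ by
        simp [image_eq_zero_of_notMem_tsupport hx]
    · intro x
      by_cases hx : β.rOut ≤ dist x 0
      · simp [β.zero_of_le_dist hx]
      · have hx' : |x| < lam / 2 := by
          rw [not_le, dist_zero_right, Real.norm_eq_abs] at hx
          exact hx
        have h2 := abs_lt.mp hx'
        exact mul_nonneg (by nlinarith) (sq_nonneg _)
    · have h0 : (β : ℝ → ℝ) 0 = 1 :=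
        β.one_of_mem_closedBall (Metric.mem_closedBall_self (by positivity))
      have e : (lam ^ 2 - (0 : ℝ) ^ 2) * (β : ℝ → ℝ) 0 ^ 2 = lam ^ 2 := by rw [h0]; ring
      show (lam ^ 2 - (0 : ℝ) ^ 2) * (β : ℝ → ℝ) 0 ^ 2 ≠ 0
      rw [e]
      positivity
  -- modulate with frequency `k`, `k² = t` large
  set t : ℝ := max 0 ((C * N - R₀) / J) + 1 with ht
  have ht0 : 0 ≤ t := by have := le_max_left 0 ((C * N - R₀) / J); linarith
  obtain ⟨ψ, hNψ, hRψ⟩ := exists_schwartz_modulated lam hgs hgc (Real.sqrt t)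
  refine ⟨ψ, ?_⟩
  rw [hNψ, hRψ, Real.sq_sqrt ht0]
  have h3 : C * N - R₀ ≤ max 0 ((C * N - R₀) / J) * J := by
    have := mul_le_mul_of_nonneg_right (le_max_right 0 ((C * N - R₀) / J)) hJ.le
    rwa [div_mul_cancel₀ _ hJ.ne'] at this
  rw [ht]
  nlinarith

/-- RH-FREE (PROVED). **The form of `W` on the core is not bounded below** (`λ > 0`): for every
`C` there is a Schwartz `ψ` with `⟪ψ, Wψ⟫ < C‖ψ‖²` — modulate a bump supported in `[λ, 3λ]`,
where the kinetic coefficient `λ² − x²` is NEGATIVE (the operator-specific reason the spectrum is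
unbounded on both sides). [cite: ConnesMoscovici2022, Thm 1.6 (iv) (= arXiv Thm 2.6 (iv), chunk p0006:L79, L105–L114)] -/
theorem exists_schwartz_rayleigh_lt (hlam : 0 < lam) (C : ℝ) :
    ∃ ψ : 𝓢(ℝ, ℂ),
      (⟪(schwartzToL2 ψ : L2R),
          prolateCore lam ⟨schwartzToL2 ψ, LinearMap.mem_range_self _ ψ⟩⟫_ℂ).re <
        C * ‖(schwartzToL2 ψ : L2R)‖ ^ 2 := by
  let β : ContDiffBump (2 * lam) := ⟨lam / 2, lam, by positivity, by linarith⟩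
  have hgs : ContDiff ℝ ∞ (β : ℝ → ℝ) := β.contDiff
  have hgc : HasCompactSupport (β : ℝ → ℝ) := β.hasCompactSupport
  set R₀ : ℝ := ∫ x, ((lam ^ 2 - x ^ 2) * deriv (β : ℝ → ℝ) x ^ 2 +
    (2 * π * lam) ^ 2 * x ^ 2 * (β : ℝ → ℝ) x ^ 2) with hR₀
  set J : ℝ := ∫ x, (lam ^ 2 - x ^ 2) * (β : ℝ → ℝ) x ^ 2 with hJdef
  set N : ℝ := ∫ x, (β : ℝ → ℝ) x ^ 2 with hN
  -- `J < 0`: `−`integrand is continuous, nonnegative, and equals `3λ²` at `2λ`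
  have hJ : J < 0 := by
    have hneg : 0 < ∫ x, (x ^ 2 - lam ^ 2) * (β : ℝ → ℝ) x ^ 2 := by
      refine integral_pos_of_integrable_nonneg_nonzero (x := 2 * lam) (by fun_prop) ?_ ?_ ?_
      · exact integrable_of_tsupport hgc (by fun_prop) fun x hx ↦ by
          simp [image_eq_zero_of_notMem_tsupport hx]
      · intro x
        by_cases hx : β.rOut ≤ dist x (2 * lam)
        · simp [β.zero_of_le_dist hx]
        · have hx' : |x - 2 * lam| < lam := by
            rw [not_le, Real.dist_eq] at hx
            exact hx
          have h2 := abs_lt.mp hx'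
          exact mul_nonneg (by nlinarith) (sq_nonneg _)
      · have h0 : (β : ℝ → ℝ) (2 * lam) = 1 :=
          β.one_of_mem_closedBall (Metric.mem_closedBall_self (by positivity))
        have e : ((2 * lam) ^ 2 - lam ^ 2) * (β : ℝ → ℝ) (2 * lam) ^ 2 = 3 * lam ^ 2 := by
          rw [h0]; ring
        show ((2 * lam) ^ 2 - lam ^ 2) * (β : ℝ → ℝ) (2 * lam) ^ 2 ≠ 0
        rw [e]
        positivity
    have hJ' : J = -∫ x, (x ^ 2 - lam ^ 2) * (β : ℝ → ℝ) x ^ 2 := by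
      rw [hJdef, ← integral_neg]
      congr 1
      funext x
      ring
    rw [hJ']
    linarith
  -- modulate with frequency `k`, `k² = t` large
  set t : ℝ := max 0 ((C * N - R₀) / J) + 1 with ht
  have ht0 : 0 ≤ t := by have := le_max_left 0 ((C * N - R₀) / J); linarith
  obtain ⟨ψ, hNψ, hRψ⟩ := exists_schwartz_modulated lam hgs hgc (Real.sqrt t)
  refine ⟨ψ, ?_⟩
  rw [hNψ, hRψ, Real.sq_sqrt ht0]
  have h3 : max 0 ((C * N - R₀) / J) * J ≤ C * N - R₀ := by
    have := mul_le_mul_of_nonpos_right (le_max_right 0 ((C * N - R₀) / J)) hJ.le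
    rwa [div_mul_cancel₀ _ hJ.ne] at this
  rw [ht]
  nlinarith

end TestFunctions

/-! ## §3. Symmetric extensions of the core with an orthonormal eigenbasis -/

section Eigenbasis

variable (lam : ℝ) {W : L2R →ₗ.[ℂ] L2R}

/-- `⟪bₙ, Wξ⟫ = μₙ ⟪bₙ, ξ⟫` for a symmetric `W` with eigenvector `bₙ` (real eigenvalue). [folklore] -/
private theorem inner_eigenvector_map (hW : W.IsSymmetric) (b : HilbertBasis ℕ ℂ L2R) (μ : ℕ → ℝ)
    (heig : ∀ n, ∃ h : (b n : L2R) ∈ W.domain, W ⟨b n, h⟩ = ((μ n : ℝ) : ℂ) • (b n : L2R))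
    (ξ : W.domain) (n : ℕ) :
    ⟪(b n : L2R), (W ξ : L2R)⟫_ℂ = ((μ n : ℝ) : ℂ) * ⟪(b n : L2R), (ξ : L2R)⟫_ℂ := by
  obtain ⟨hn, hWn⟩ := heig n
  rw [← hW ⟨b n, hn⟩ ξ, hWn, inner_smul_left, Complex.conj_ofReal]

/-- Parseval for a Hilbert basis: `Σ |⟪bₙ, ξ⟫|² = ‖ξ‖²`. [folklore] -/
private theorem hasSum_sq_inner (b : HilbertBasis ℕ ℂ L2R) (ξ : L2R) :
    HasSum (fun n ↦ ‖⟪(b n : L2R), ξ⟫_ℂ‖ ^ 2) (‖ξ‖ ^ 2) := by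
  have h := Complex.hasSum_re (b.hasSum_inner_mul_inner ξ ξ)
  convert h using 1
  · funext n
    rw [← inner_conj_symm ξ (b n), Complex.conj_mul', ← Complex.ofReal_pow, Complex.ofReal_re]
  · rw [inner_self_eq_norm_sq_to_K]
    norm_cast

/-- **Spectral form of the quadratic form**: `re ⟪ξ, Wξ⟫ = Σ μₙ |⟪bₙ, ξ⟫|²` for `ξ ∈ dom W`.
[folklore] -/
private theorem hasSum_eigenvalue_mul_sq_inner (hW : W.IsSymmetric) (b : HilbertBasis ℕ ℂ L2R)
    (μ : ℕ → ℝ)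
    (heig : ∀ n, ∃ h : (b n : L2R) ∈ W.domain, W ⟨b n, h⟩ = ((μ n : ℝ) : ℂ) • (b n : L2R))
    (ξ : W.domain) :
    HasSum (fun n ↦ μ n * ‖⟪(b n : L2R), (ξ : L2R)⟫_ℂ‖ ^ 2) (⟪(ξ : L2R), (W ξ : L2R)⟫_ℂ).re := by
  have h := Complex.hasSum_re (b.hasSum_inner_mul_inner (ξ : L2R) (W ξ : L2R))
  convert h using 1
  funext n
  rw [inner_eigenvector_map hW b μ heig ξ n, ← inner_conj_symm (ξ : L2R) (b n), mul_left_comm,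
    Complex.conj_mul', ← Complex.ofReal_pow, ← Complex.ofReal_mul, Complex.ofReal_re]

/-- If all eigenvalues are `≤ C` then `re ⟪ξ, Wξ⟫ ≤ C‖ξ‖²` on `dom W`. [folklore] -/
private theorem re_inner_map_le (hW : W.IsSymmetric) (b : HilbertBasis ℕ ℂ L2R) (μ : ℕ → ℝ)
    (heig : ∀ n, ∃ h : (b n : L2R) ∈ W.domain, W ⟨b n, h⟩ = ((μ n : ℝ) : ℂ) • (b n : L2R))
    (C : ℝ) (hC : ∀ n, μ n ≤ C) (ξ : W.domain) :
    (⟪(ξ : L2R), (W ξ : L2R)⟫_ℂ).re ≤ C * ‖(ξ : L2R)‖ ^ 2 :=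
  hasSum_le (fun n ↦ mul_le_mul_of_nonneg_right (hC n) (sq_nonneg _))
    (hasSum_eigenvalue_mul_sq_inner hW b μ heig ξ) ((hasSum_sq_inner b (ξ : L2R)).mul_left C)

/-- If all eigenvalues are `≥ C` then `C‖ξ‖² ≤ re ⟪ξ, Wξ⟫` on `dom W`. [folklore] -/
private theorem le_re_inner_map (hW : W.IsSymmetric) (b : HilbertBasis ℕ ℂ L2R) (μ : ℕ → ℝ)
    (heig : ∀ n, ∃ h : (b n : L2R) ∈ W.domain, W ⟨b n, h⟩ = ((μ n : ℝ) : ℂ) • (b n : L2R))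
    (C : ℝ) (hC : ∀ n, C ≤ μ n) (ξ : W.domain) :
    C * ‖(ξ : L2R)‖ ^ 2 ≤ (⟪(ξ : L2R), (W ξ : L2R)⟫_ℂ).re :=
  hasSum_le (fun n ↦ mul_le_mul_of_nonneg_right (hC n) (sq_nonneg _))
    ((hasSum_sq_inner b (ξ : L2R)).mul_left C) (hasSum_eigenvalue_mul_sq_inner hW b μ heig ξ)

/-- RH-FREE (PROVED). **Sign clause, upper half.** For `λ > 0`, a SYMMETRIC extension `W` of the
prolate core (`⟪Wx, y⟫ = ⟪x, Wy⟫` on `dom W ⊇ 𝒮(ℝ)`) and an orthonormal eigenbasis `(bₙ, μₙ)` of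
`W`: the eigenvalues are **not bounded above** (else `re ⟪ξ, Wξ⟫ = Σ μₙ|⟪bₙ, ξ⟫|² ≤ C‖ξ‖²` on
`dom W`, contradicting `exists_schwartz_rayleigh_gt`). [cite: ConnesMoscovici2022, Thm 1.6 (iv) (= arXiv Thm 2.6 (iv), chunk p0006:L79, L105–L114)] -/
theorem not_bddAbove_of_eigenbasis (hlam : 0 < lam) (hW : W.IsSymmetric)
    (hle : prolateCore lam ≤ W) (b : HilbertBasis ℕ ℂ L2R) (μ : ℕ → ℝ)
    (heig : ∀ n, ∃ h : (b n : L2R) ∈ W.domain, W ⟨b n, h⟩ = ((μ n : ℝ) : ℂ) • (b n : L2R)) :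
    ¬BddAbove (Set.range μ) := by
  rintro ⟨C, hC⟩
  have hC' : ∀ n, μ n ≤ C := fun n ↦ hC ⟨n, rfl⟩
  obtain ⟨ψ, hψ⟩ := exists_schwartz_rayleigh_gt lam hlam C
  let ξ : W.domain := ⟨schwartzToL2 ψ, hle.1 (LinearMap.mem_range_self _ ψ)⟩
  have hWξ : prolateCore lam ⟨schwartzToL2 ψ, LinearMap.mem_range_self _ ψ⟩ = W ξ := hle.2 rfl
  have h := re_inner_map_le hW b μ heig C hC' ξ
  rw [← hWξ] at h
  exact absurd (hψ.trans_le h) (lt_irrefl _)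

/-- RH-FREE (PROVED). **Sign clause, lower half.** Same setting: the eigenvalues are **not
bounded below** (by `exists_schwartz_rayleigh_lt`). [cite: ConnesMoscovici2022, Thm 1.6 (iv) (= arXiv Thm 2.6 (iv), chunk p0006:L79, L105–L114)] -/
theorem not_bddBelow_of_eigenbasis (hlam : 0 < lam) (hW : W.IsSymmetric)
    (hle : prolateCore lam ≤ W) (b : HilbertBasis ℕ ℂ L2R) (μ : ℕ → ℝ)
    (heig : ∀ n, ∃ h : (b n : L2R) ∈ W.domain, W ⟨b n, h⟩ = ((μ n : ℝ) : ℂ) • (b n : L2R)) :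
    ¬BddBelow (Set.range μ) := by
  rintro ⟨C, hC⟩
  have hC' : ∀ n, C ≤ μ n := fun n ↦ hC ⟨n, rfl⟩
  obtain ⟨ψ, hψ⟩ := exists_schwartz_rayleigh_lt lam hlam C
  let ξ : W.domain := ⟨schwartzToL2 ψ, hle.1 (LinearMap.mem_range_self _ ψ)⟩
  have hWξ : prolateCore lam ⟨schwartzToL2 ψ, LinearMap.mem_range_self _ ψ⟩ = W ξ := hle.2 rfl
  have h := le_re_inner_map hW b μ heig C hC' ξ
  rw [← hWξ] at h
  exact absurd (h.trans_lt hψ) (lt_irrefl _)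

end Eigenbasis

/-! ## §4. Assembly: clause (iv) from a compact resolvent -/

section Assembly

variable (lam : ℝ)

/-- `L²(ℝ)` is infinite-dimensional (it contains the infinite-dimensional Sonin space `S(1,1)`,
tree theorem `not_finiteDimensional_soninSpace_of_nonneg`). [folklore] -/
private theorem not_finiteDimensional_L2R : ¬FiniteDimensional ℂ L2R := by
  intro h
  exact not_finiteDimensional_soninSpace_of_nonneg (a := 1) (b := 1) zero_le_one inferInstance

/-- RH-FREE (PROVED). **A self-adjoint restriction of `W_max` extends the core**: if `W = W*` and
`W ⊂ W_max = (W|_𝒮)*` then `W|_𝒮 ⊂ (W_max)* ⊂ W* = W` (adjoints reverse inclusions). In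
particular every `W_sa` of Theorem 1.6 contains the Schwartz core. [cite: ConnesMoscovici2022, §1 ¶1 and Thm 1.6 (i) (= arXiv §2 ¶1, Thm 2.6 (i), chunk p0004:L13–L22, p0006:L76–L79)] -/
theorem prolateCore_le_of_isSelfAdjoint {W : L2R →ₗ.[ℂ] L2R} (hW : IsSelfAdjoint W)
    (hle : W ≤ prolateMax lam) : prolateCore lam ≤ W := by
  have hcm : prolateCore lam ≤ prolateMax lam :=
    LinearPMap.IsFormalAdjoint.le_adjoint dense_schwartzL2 (prolateCore_symmetric lam)
  have hdM : Dense ((prolateMax lam).domain : Set L2R) :=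
    dense_schwartzL2.mono fun x hx ↦ hcm.1 hx
  have h1 : prolateCore lam ≤ (prolateMax lam).adjoint :=
    LinearPMap.IsFormalAdjoint.le_adjoint hdM (LinearPMap.adjoint_isFormalAdjoint dense_schwartzL2)
  have h2 : (prolateMax lam).adjoint ≤ W.adjoint := adjoint_le_adjoint_of_le hW.dense_domain hle
  rw [LinearPMap.isSelfAdjoint_def.mp hW] at h2
  exact h1.trans h2

/-- RH-FREE (PROVED). **Theorem 1.6 (iv) from a compact resolvent.** For `λ > 0` and a
self-adjoint extension `W` of the prolate core (`prolateCore λ ≤ W`) whose resolvent is compact at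
one non-real point: `W` has an orthonormal eigenbasis `(bₙ)ₙ∈ℕ` with real eigenvalues `μₙ`,
`|μₙ| → ∞`, and `{μₙ}` is bounded NEITHER above NOR below — the tree's typing
`HasDiscreteSpectrumUnboundedBothSides W` of "the spectrum of `W_sa` is discrete and unbounded on
both sides".  Ingredients: the abstract compact-resolvent eigenbasis
(`exists_hilbertBasis_nat_eigenvectors_of_compact_resolvent`, Schmüdgen 2012 Prop 5.12) and the
sign clause of §3.  The remaining input for `W_sa` itself — compactness of its resolvent, the
Sturm–Liouville limit-circle statement of the printed proof — is NOT proved here.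
[cite: ConnesMoscovici2022, Thm 1.6 (iv) (= arXiv Thm 2.6 (iv), chunk p0006:L79; proof L105–L114)] -/
theorem hasDiscreteSpectrumUnboundedBothSides_of_compact_resolvent (hlam : 0 < lam)
    {W : L2R →ₗ.[ℂ] L2R} (hW : IsSelfAdjoint W) (hle : prolateCore lam ≤ W) {z : ℂ}
    (hz : z.im ≠ 0) (hK : IsCompactOperator (resolvent hW hz)) :
    HasDiscreteSpectrumUnboundedBothSides W := by
  obtain ⟨b, μ, heig, htend⟩ :=
    exists_hilbertBasis_nat_eigenvectors_of_compact_resolvent not_finiteDimensional_L2R hW hz hK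
  exact ⟨b, μ, heig, htend,
    not_bddAbove_of_eigenbasis lam hlam hW.isSymmetric_linearPMap hle b μ heig,
    not_bddBelow_of_eigenbasis lam hlam hW.isSymmetric_linearPMap hle b μ heig⟩

/-- RH-FREE (PROVED). **Theorem 1.6 (iv) for `W_sa`, modulo (i) and the compact resolvent**: if
`W` is the restriction of `W_max` to `𝓛_β` (`IsProlateSA λ W`), is self-adjoint (clause (i)) and
has compact resolvent at one non-real point, then `HasDiscreteSpectrumUnboundedBothSides W` — the
exact conjunct (iv) of the tree's `CM22_thm_1_6`. [cite: ConnesMoscovici2022, Thm 1.6 (iv) (= arXiv Thm 2.6 (iv), chunk p0006:L79; proof L105–L114)] -/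
theorem hasDiscreteSpectrumUnboundedBothSides_of_isProlateSA (hlam : 0 < lam)
    {W : L2R →ₗ.[ℂ] L2R} (hWsa : IsProlateSA lam W) (hW : IsSelfAdjoint W) {z : ℂ}
    (hz : z.im ≠ 0) (hK : IsCompactOperator (resolvent hW hz)) :
    HasDiscreteSpectrumUnboundedBothSides W :=
  hasDiscreteSpectrumUnboundedBothSides_of_compact_resolvent lam hlam hW
    (prolateCore_le_of_isSelfAdjoint lam hW hWsa.1) hz hK

end Assembly

end Literature.NumberTheory.ConnesMoscovici2022

end
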